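import Summits.CriticalPhenomena.SAWScalingLimit.Theses.SAWDefectDecoherence
import Summits.CriticalPhenomena.SAWScalingLimit.Theorems.SAWDefectDecoherenceObservableToSLERTwoPieceRestrictionLimit
import HarnessLib

/-!
# The two-piece admissible restriction limit from MACROSCOPIC source locality
# (stub 5a1⁻ glue of the line `bridge-gate-renewal`, crux `SAWDefectDecoherence.ObservableToSLER`)

Crux item stmt-CriticalPhenomena-14005 (`Iff.rfl`-twin of stmt-CriticalPhenomena-10472).  The line's anchor input
5a1/T1 `TwoPieceSourceLocality` (K-uniform arch tightness: arches of span `t` from a flat-pinned source stay within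
`K |t|`) is consumed ONLY by the two-piece admissible restriction limit ARL″ (5a2,
`ObservableToSLER.TwoPiece.stub_twoPieceAdmRestrictionLimit`, p121515), and there at ONE fixed macroscopic radius.
This file records the weakening found by the crux-strategist seat of the twin crux
(`Cruxes/ObservableToSLE/Lines/macro_anchor_split.lean`, §1, 2026-08-17; proofs adapted verbatim from that
workfile, with the route hypothesis `HexObservableLimitR` ≡ `HexObservableLimit`, same term):

* `macroSourceLocality_of_twoPieceSourceLocality` — the K-uniform anchor implies the MACROSCOPIC SOURCE
  LOCALITY (`∀ ε ∀ r > 0 ∃ t₀ …`: the `x_c`-mass of chords `a δ → s δ`, `s δ → pt 0 + t`, `|t| < t₀`, reaching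
  scaled distance `≥ r` from the source is `≤ ε ·` total);
* `stub_macroRestrictionLimit` (registered) — `HexObservableLimitR → MacroSourceLocality → ARL″` (the 5a2
  bootstrap re-run with the far threshold `K |t|` replaced by the fixed radius `ρ / 4`).

So the line's anchor stub can be the strictly weaker macroscopic locality (skeleton r13), which in substance is
locked to DCS Conjecture 1 (LSW restriction: chordal SLE(8/3) in `(E; a, s_t)` leaves `B(a, r)` with probability
`1 - (1 - O(t²/r²))^{5/8}`), whereas the K-uniform anchor is not (Disproof §10.4 of the twin crux).

Sources: G. F. Lawler, O. Schramm, W. Werner, J. Amer. Math. Soc. 16 (2003), Thm. 6.1; H. Duminil-Copin,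
S. Smirnov, Ann. of Math. 175 (2012), Lemma 2.
-/

noncomputable section

open scoped BigOperators Topology NNReal ENNReal Classical BoundedContinuousFunction ComplexConjugate
open Filter Set MeasureTheory Metric
open Literature.Probability.LatticeModels (HexVertex hexGraph hexCenter triZeta Site polyline)
open Literature.Probability.RandomPlanarGeometry
open Literature.Probability.RandomPlanarGeometry.SAW
open UpperHalfPlane (upperHalfPlaneSet)

namespace Summit.CriticalPhenomena.SAWScalingLimit.Theorems.ObservableToSLER.Macro

open Summit.CriticalPhenomena.SAWScalingLimit.Theses.SAWDefectDecoherence (HexObservableLimitR)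
open Summit.CriticalPhenomena.SAWScalingLimit.Theorems.ObservableToSLE.FloorRatio
  (exists_conformalPackage flat_of_subset tendsto_of_forall_squeeze exists_remark
    stub_targetTransport norm_exp_five_eighths sum_pow_length_pos exists_injective_verts_eq
    archMass_mono)
open Summit.CriticalPhenomena.SAWScalingLimit.Theorems.ObservableToSLER.TwoPiece
  (norm_observable_eq_archMass archMass_le_archMass_add_farMass_mesh twoPieceFloorData)

/-! ### The macroscopic anchor suffices for the two-piece admissible restriction limit -/

/-- The `K`-uniform anchor of the live lines (`TwoPieceSourceLocality`, twin r7 stub 5a1 = T1, same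
text) implies the macroscopic one: given `r`, take `t₀' = min t₀ (r / K)`, so that `K |t| < r`. -/
-- adapted from Cruxes/ObservableToSLE/Lines/macro_anchor_split.lean §1 (crux-strategist, 10472)
theorem macroSourceLocality_of_twoPieceSourceLocality :
    (∀ (E : DobrushinDomain) (ρ : ℝ) (Λ : ℝ → Finset HexVertex) (m₀ : ℝ → ℤ)
      (a : ℝ → Sym2 HexVertex),
      0 < ρ → E.carrier ∩ ball (E.pt 0) ρ = {z : ℂ | (E.pt 0).im < z.im} ∩ ball (E.pt 0) ρ →
      (∀ᶠ δ : ℝ in 𝓝[>] 0, hexDomainSimplyConnected (Λ δ) ∧ a δ ∈ hexDomainBoundary (Λ δ) ∧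
        (∀ v ∈ Λ δ, (δ : ℂ) * hexCenter v ∈ E.carrier) ∧
        (∀ v : HexVertex, (δ : ℂ) * hexCenter v ∈ ball (E.pt 0) ρ → (v ∈ Λ δ ↔ m₀ δ ≤ v.1 1))) →
      Tendsto (fun δ : ℝ => (δ : ℂ) * hexMidpoint (a δ)) (𝓝[>] 0) (𝓝 (E.pt 0)) →
      ∀ ε : ℝ, 0 < ε → ∃ K : ℝ, 0 < K ∧ ∃ t₀ : ℝ, 0 < t₀ ∧
        ∀ (s : ℝ → Sym2 HexVertex) (t : ℝ), t ≠ 0 → |t| < t₀ →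
          (∀ᶠ δ : ℝ in 𝓝[>] 0, s δ ∈ hexDomainBoundary (Λ δ) ∧
            (hexMidpoint (s δ)).im = (hexMidpoint (a δ)).im) →
          Tendsto (fun δ : ℝ => (δ : ℂ) * hexMidpoint (s δ)) (𝓝[>] 0) (𝓝 (E.pt 0 + t)) →
          ∀ᶠ δ : ℝ in 𝓝[>] 0,
            (∑ γ : HexMidEdgeSAW (Λ δ) (a δ) (s δ),
                if ∃ v ∈ γ.verts, K * |t| ≤ dist ((δ : ℂ) * hexCenter v) ((δ : ℂ) * hexMidpoint (a δ))
                then hexCriticalFugacity ^ γ.length else 0) ≤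
              ε * ∑ γ : HexMidEdgeSAW (Λ δ) (a δ) (s δ), hexCriticalFugacity ^ γ.length) →
    (∀ (E : DobrushinDomain) (ρ : ℝ) (Λ : ℝ → Finset HexVertex) (m₀ : ℝ → ℤ)
      (a : ℝ → Sym2 HexVertex),
      0 < ρ → E.carrier ∩ ball (E.pt 0) ρ = {z : ℂ | (E.pt 0).im < z.im} ∩ ball (E.pt 0) ρ →
      (∀ᶠ δ : ℝ in 𝓝[>] 0, hexDomainSimplyConnected (Λ δ) ∧
        (hexGraph.induce (↑(Λ δ) : Set HexVertex)).Preconnected ∧ a δ ∈ hexDomainBoundary (Λ δ) ∧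
        (∀ v ∈ Λ δ, (δ : ℂ) * hexCenter v ∈ E.carrier) ∧
        (∀ v : HexVertex, (δ : ℂ) * hexCenter v ∈ ball (E.pt 0) ρ → (v ∈ Λ δ ↔ m₀ δ ≤ v.1 1))) →
      (∀ K : Set ℂ, IsCompact K → K ⊆ E.carrier →
        ∀ᶠ δ : ℝ in 𝓝[>] 0, ∀ v : HexVertex, (δ : ℂ) * hexCenter v ∈ K → v ∈ Λ δ) →
      Tendsto (fun δ : ℝ => (δ : ℂ) * hexMidpoint (a δ)) (𝓝[>] 0) (𝓝 (E.pt 0)) →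
      ∀ ε : ℝ, 0 < ε → ∀ r : ℝ, 0 < r → ∃ t₀ : ℝ, 0 < t₀ ∧
        ∀ (s : ℝ → Sym2 HexVertex) (t : ℝ), t ≠ 0 → |t| < t₀ →
          (∀ᶠ δ : ℝ in 𝓝[>] 0, s δ ∈ hexDomainBoundary (Λ δ) ∧
            (hexMidpoint (s δ)).im = (hexMidpoint (a δ)).im) →
          Tendsto (fun δ : ℝ => (δ : ℂ) * hexMidpoint (s δ)) (𝓝[>] 0) (𝓝 (E.pt 0 + t)) →
          ∀ᶠ δ : ℝ in 𝓝[>] 0,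
            (∑ γ : HexMidEdgeSAW (Λ δ) (a δ) (s δ),
                if ∃ v ∈ γ.verts, r ≤ dist ((δ : ℂ) * hexCenter v) ((δ : ℂ) * hexMidpoint (a δ))
                then hexCriticalFugacity ^ γ.length else 0) ≤
              ε * ∑ γ : HexMidEdgeSAW (Λ δ) (a δ) (s δ), hexCriticalFugacity ^ γ.length) := by
  intro hSL E ρ Λ m₀ a hρ hflat hev _hK ha ε hε r hr
  obtain ⟨K, hK, t₀, ht₀, h⟩ := hSL E ρ Λ m₀ a hρ hflat
    (hev.mono fun δ h => ⟨h.1, h.2.2.1, h.2.2.2.1, h.2.2.2.2⟩) ha ε hε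
  refine ⟨min t₀ (r / K), lt_min ht₀ (div_pos hr hK), fun s t ht htlt hs hst => ?_⟩
  have ht₀' : |t| < t₀ := htlt.trans_le (min_le_left _ _)
  have hKt : K * |t| < r := by
    have := htlt.trans_le (min_le_right _ _)
    rwa [lt_div_iff₀ hK, mul_comm] at this
  filter_upwards [h s t ht ht₀' hs hst] with δ hδ
  refine le_trans (Finset.sum_le_sum fun γ _ => ?_) hδ
  by_cases hfar : ∃ v ∈ γ.verts, r ≤ dist ((δ : ℂ) * hexCenter v) ((δ : ℂ) * hexMidpoint (a δ))
  · obtain ⟨v, hv, hvd⟩ := hfar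
    have hK' : ∃ v ∈ γ.verts,
        K * |t| ≤ dist ((δ : ℂ) * hexCenter v) ((δ : ℂ) * hexMidpoint (a δ)) :=
      ⟨v, hv, hKt.le.trans hvd⟩
    rw [if_pos ⟨v, hv, hvd⟩, if_pos hK']
  · rw [if_neg hfar]
    split_ifs
    · exact pow_nonneg hexCriticalFugacity_pos_lt_one.1.le _
    · exact le_rfl

/-- **The two-piece admissible restriction limit from the MACROSCOPIC anchor**:
`HexObservableLimit → MacroSourceLocality → TwoPieceAdmRestrictionLimit` (the conclusion is the twin
r7 statement ARL″ verbatim, = the registered stub signature of T2a's input).  Proof: the landed 5a2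
bootstrap (`ObservableToSLER.TwoPiece.stub_twoPieceAdmRestrictionLimit`, p121515) with the far
threshold `K |t|` replaced by the fixed radius `ρ / 4` inside the common flat ball at `pt 0` — target
transport twice (`FloorRatio.stub_targetTransport`), boundary winding rigidity, coalescence
`R(t) → Φ_A'(0)^{5/8}`, and the squeeze `1 - η ≤ Z_{Λ'}(a,s)/Z_Λ(a,s) ≤ 1` from macroscopic
source locality (the near chords within `ρ/4` of `a` are chords of `Λ'`).
[cite: LawlerSchrammWerner2003Restriction, Thm. 6.1 (p. 23)] -/
-- adapted from Cruxes/ObservableToSLE/Lines/macro_anchor_split.lean §1 (crux-strategist, 10472)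
theorem stub_macroRestrictionLimit :
    HexObservableLimitR →
    (∀ (E : DobrushinDomain) (ρ : ℝ) (Λ : ℝ → Finset HexVertex) (m₀ : ℝ → ℤ)
      (a : ℝ → Sym2 HexVertex),
      0 < ρ → E.carrier ∩ ball (E.pt 0) ρ = {z : ℂ | (E.pt 0).im < z.im} ∩ ball (E.pt 0) ρ →
      (∀ᶠ δ : ℝ in 𝓝[>] 0, hexDomainSimplyConnected (Λ δ) ∧
        (hexGraph.induce (↑(Λ δ) : Set HexVertex)).Preconnected ∧ a δ ∈ hexDomainBoundary (Λ δ) ∧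
        (∀ v ∈ Λ δ, (δ : ℂ) * hexCenter v ∈ E.carrier) ∧
        (∀ v : HexVertex, (δ : ℂ) * hexCenter v ∈ ball (E.pt 0) ρ → (v ∈ Λ δ ↔ m₀ δ ≤ v.1 1))) →
      (∀ K : Set ℂ, IsCompact K → K ⊆ E.carrier →
        ∀ᶠ δ : ℝ in 𝓝[>] 0, ∀ v : HexVertex, (δ : ℂ) * hexCenter v ∈ K → v ∈ Λ δ) →
      Tendsto (fun δ : ℝ => (δ : ℂ) * hexMidpoint (a δ)) (𝓝[>] 0) (𝓝 (E.pt 0)) →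
      ∀ ε : ℝ, 0 < ε → ∀ r : ℝ, 0 < r → ∃ t₀ : ℝ, 0 < t₀ ∧
        ∀ (s : ℝ → Sym2 HexVertex) (t : ℝ), t ≠ 0 → |t| < t₀ →
          (∀ᶠ δ : ℝ in 𝓝[>] 0, s δ ∈ hexDomainBoundary (Λ δ) ∧
            (hexMidpoint (s δ)).im = (hexMidpoint (a δ)).im) →
          Tendsto (fun δ : ℝ => (δ : ℂ) * hexMidpoint (s δ)) (𝓝[>] 0) (𝓝 (E.pt 0 + t)) →
          ∀ᶠ δ : ℝ in 𝓝[>] 0,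
            (∑ γ : HexMidEdgeSAW (Λ δ) (a δ) (s δ),
                if ∃ v ∈ γ.verts, r ≤ dist ((δ : ℂ) * hexCenter v) ((δ : ℂ) * hexMidpoint (a δ))
                then hexCriticalFugacity ^ γ.length else 0) ≤
              ε * ∑ γ : HexMidEdgeSAW (Λ δ) (a δ) (s δ), hexCriticalFugacity ^ γ.length) →
    ∀ (D D' : DobrushinDomain) (ρ : ℝ) (φ : ConformalEquiv upperHalfPlaneSet D.carrier)
      (Φ : ConformalEquiv (upperHalfPlaneSet \ φ.pullbackHull D') upperHalfPlaneSet) (d : ℝ)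
      (Λ Λ' : ℝ → Finset HexVertex) (m₀ m₁ m₁' : ℝ → ℤ) (a b : ℝ → Sym2 HexVertex),
      (0 < ρ ∧ ∀ i : Fin 2, D.carrier ∩ ball (D.pt i) ρ = {z : ℂ | (D.pt i).im < z.im} ∩ ball (D.pt i) ρ) →
      D.IsHullSubdomain D' → D.IsChordalUniformizing φ →
      IsRestrictionMap (φ.pullbackHull D') Φ → HasRestrictionDeriv (φ.pullbackHull D') Φ d →
      (∀ᶠ δ : ℝ in 𝓝[>] 0,
        Λ' δ ⊆ Λ δ ∧ hexDomainSimplyConnected (Λ δ) ∧ hexDomainSimplyConnected (Λ' δ) ∧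
        (hexGraph.induce (↑(Λ δ) : Set HexVertex)).Preconnected ∧
        (hexGraph.induce (↑(Λ' δ) : Set HexVertex)).Preconnected ∧
        a δ ∈ hexDomainBoundary (Λ δ) ∧ b δ ∈ hexDomainBoundary (Λ δ) ∧
        a δ ∈ hexDomainBoundary (Λ' δ) ∧ b δ ∈ hexDomainBoundary (Λ' δ) ∧
        Nonempty (HexMidEdgeSAW (Λ' δ) (a δ) (b δ)) ∧
        (∀ v ∈ Λ δ, (δ : ℂ) * hexCenter v ∈ D.carrier) ∧
        (∀ v ∈ Λ' δ, (δ : ℂ) * hexCenter v ∈ D'.carrier) ∧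
        (∀ v : HexVertex, (δ : ℂ) * hexCenter v ∈ ball (D.pt 0) ρ →
          ((v ∈ Λ δ ↔ m₀ δ ≤ v.1 1) ∧ (v ∈ Λ' δ ↔ m₀ δ ≤ v.1 1))) ∧
        (∀ v : HexVertex, (δ : ℂ) * hexCenter v ∈ ball (D.pt 1) ρ →
          ((v ∈ Λ δ ↔ m₁ δ ≤ v.1 1) ∧ (v ∈ Λ' δ ↔ m₁' δ ≤ v.1 1)))) →
      (∀ K : Set ℂ, IsCompact K → K ⊆ D.carrier →
        ∀ᶠ δ : ℝ in 𝓝[>] 0, ∀ v : HexVertex, (δ : ℂ) * hexCenter v ∈ K → v ∈ Λ δ) →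
      (∀ K : Set ℂ, IsCompact K → K ⊆ D'.carrier →
        ∀ᶠ δ : ℝ in 𝓝[>] 0, ∀ v : HexVertex, (δ : ℂ) * hexCenter v ∈ K → v ∈ Λ' δ) →
      Tendsto (fun δ : ℝ => (δ : ℂ) * hexMidpoint (a δ)) (𝓝[>] 0) (𝓝 (D.pt 0)) →
      Tendsto (fun δ : ℝ => (δ : ℂ) * hexMidpoint (b δ)) (𝓝[>] 0) (𝓝 (D.pt 1)) →
      Tendsto (fun δ : ℝ =>
          (∑ γ : HexMidEdgeSAW (Λ' δ) (a δ) (b δ), hexCriticalFugacity ^ γ.length) /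
            (∑ γ : HexMidEdgeSAW (Λ δ) (a δ) (b δ), hexCriticalFugacity ^ γ.length)) (𝓝[>] 0)
        (𝓝 (d ^ ((5 : ℝ) / 8))) := by
  intro hO hSL D D' ρ φ Φ d Λ Λ' m₀ m₁ m₁' a b hfl hD' hφ hΦ hd hev hKΛ hKΛ' ha hb
  obtain ⟨hρ, hflat⟩ := hfl
  have hflat0 := hflat 0
  have hflat1 := hflat 1
  obtain ⟨Ψ, L, Lb, Ψ', L', L'b, ρ₁, R, hρ₁, hρ₁ρ, hΨinf, hΨb, hLc, hLe, hLb, hΨ'inf, hΨ'b, hL'c,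
    hL'e, hL'b, hflat0', hflat1', hfloor, hR⟩ :=
    exists_conformalPackage D D' ρ φ Φ d hρ hflat0 hflat1 hD' hφ hΦ hd
  -- two-piece source locality in the ball at `pt 0`, for the family `Λ`
  have hSLD := hSL D ρ Λ m₀ a hρ hflat0 (by
      filter_upwards [hev] with δ hevδ
      obtain ⟨-, hscΛ, -, hconn, -, haΛ, -, -, -, -, hΛD, -, hrows0, -⟩ := hevδ
      exact ⟨hscΛ, hconn, haΛ, hΛD, fun v hv => (hrows0 v hv).1⟩) hKΛ ha
  refine tendsto_of_forall_squeeze fun η hη => ?_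
  -- macroscopic source locality at the FIXED radius `ρ / 4`
  obtain ⟨t₀, ht₀, hSLK⟩ := hSLD η hη (ρ / 4) (by positivity)
  -- choice of the floor point `s = a + t`
  obtain ⟨t, ht0, htρ, htt₀, htR⟩ : ∃ t : ℝ, 0 < t ∧ t < ρ₁ / 4 ∧ t < t₀ ∧
      |R t - d ^ ((5 : ℝ) / 8)| ≤ η := by
    have h1 : ∀ᶠ t in 𝓝[>] (0 : ℝ), t < ρ₁ / 4 := mem_nhdsWithin_of_mem_nhds (Iio_mem_nhds (by positivity))
    have h3 : ∀ᶠ t in 𝓝[>] (0 : ℝ), t < t₀ := mem_nhdsWithin_of_mem_nhds (Iio_mem_nhds ht₀)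
    have h4 : ∀ᶠ t in 𝓝[>] (0 : ℝ), |R t - d ^ ((5 : ℝ) / 8)| ≤ η := by
      filter_upwards [Metric.tendsto_nhds.1 hR η hη] with t ht
      rw [Real.dist_eq] at ht
      exact ht.le
    obtain ⟨t, ⟨h1t, h3t, h4t⟩, ht0⟩ :=
      ((h1.and (h3.and h4)).and self_mem_nhdsWithin).exists
    exact ⟨t, ht0, h1t, h3t, h4t⟩
  obtain ⟨hsfr, hsfr', hsa, Ls, L's, hLs, hL's, hRt⟩ := hfloor t ht0 (by linarith)
  set s : ℂ := D.pt 0 + t with hs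
  have hsim : s.im = (D.pt 0).im := by simp [hs]
  have hdist_s : dist s (D.pt 0) = t := by
    rw [hs, dist_eq_norm, add_sub_cancel_left, Complex.norm_real, Real.norm_eq_abs, abs_of_pos ht0]
  have htabs : |t| = t := abs_of_pos ht0
  have hKt : 2 * (ρ / 4) < ρ := by linarith
  -- the local lattice floor data at `pt 0`
  obtain ⟨sE, hsE, hevF⟩ := twoPieceFloorData (p := D.pt 0) Λ Λ' m₀ a hρ
    (by
      filter_upwards [hev] with δ hevδ
      obtain ⟨-, -, -, hconn, hconn', haΛ, -, -, -, -, -, -, hrows0, -⟩ := hevδ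
      exact ⟨hconn, hconn', haΛ, hrows0⟩)
    ha hsa hsim (by rw [hdist_s]; linarith) hKt
  -- re-marked domains `(D; a, s)`, `(D'; a, s)`
  obtain ⟨Ds, hDs_car, hDs0, hDs1⟩ := exists_remark D hsfr hsa
  obtain ⟨D's, hD's_car, hD's0, hD's1⟩ := exists_remark D' hsfr' (by rw [hD'.pt_zero_eq]; exact hsa)
  -- the transport radius `ρ₂ = ρ₁/2` and flatness
  have hballs : ball s (ρ₁ / 2) ⊆ ball (D.pt 0) ρ₁ := by
    intro z hz
    rw [mem_ball] at hz ⊢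
    calc dist z (D.pt 0) ≤ dist z s + dist s (D.pt 0) := dist_triangle _ _ _
      _ < ρ₁ / 2 + t := by rw [hdist_s]; linarith
      _ ≤ ρ₁ := by linarith
  have hballsρ : ball s (ρ₁ / 2) ⊆ ball (D.pt 0) ρ := hballs.trans (ball_subset_ball hρ₁ρ)
  have hρ₂ρ : ρ₁ / 2 ≤ ρ := by linarith
  have hf0 := flat_of_subset hflat0 (ball_subset_ball hρ₂ρ) rfl
  have hf1 := flat_of_subset hflat1 (ball_subset_ball hρ₂ρ) rfl
  have hfs := flat_of_subset hflat0 hballsρ hsim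
  have hf0' := flat_of_subset hflat0' (ball_subset_ball (by linarith : ρ₁ / 2 ≤ ρ₁)) rfl
  have hf1' := flat_of_subset hflat1' (ball_subset_ball (by linarith : ρ₁ / 2 ≤ ρ₁)) rfl
  have hfs' := flat_of_subset hflat0' hballs hsim
  -- nonempty walk spaces `a δ → b δ` in `Λ δ`
  have hevN : ∀ᶠ δ : ℝ in 𝓝[>] 0, Nonempty (HexMidEdgeSAW (Λ δ) (a δ) (b δ)) := by
    filter_upwards [hev] with δ hevδ
    obtain ⟨hsubΛ, -, -, -, -, -, -, -, -, hne', -⟩ := hevδ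
    obtain ⟨ι, -, -⟩ := exists_injective_verts_eq hsubΛ (a δ) (b δ)
    exact hne'.map ι
  -- target transport in `(D; a; b, s)` with `Λ`
  have T₁ : Tendsto (fun δ : ℝ =>
      hexParafermionicObservable (Λ δ) (a δ) hexCriticalFugacity (5 / 8) (sE δ) /
        hexParafermionicObservable (Λ δ) (a δ) hexCriticalFugacity (5 / 8) (b δ)) (𝓝[>] 0)
      (𝓝 (Complex.exp ((5 / 8 : ℂ) * (Ls - Lb)))) := by
    refine stub_targetTransport hO D Ds (ρ₁ / 2) Λ m₀ m₁ m₀ a b sE Ψ L Lb Ls hDs_car hDs0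
      (half_pos hρ₁) hf0 hf1 (by rw [hDs1]; exact hfs) ?_ hKΛ ha hb (by rw [hDs1]; exact hsE)
      hΨinf hΨb hLc hLe hLb (by rw [hDs1]; exact hLs)
    filter_upwards [hev, hevF, hevN] with δ hevδ hF hne_ab
    obtain ⟨-, hscΛ, -, hconn, -, haΛ, hbΛ, -, -, -, hΛD, -, hrows0, hrows1⟩ := hevδ
    obtain ⟨hsEbd, -, hne_as, -, -, -⟩ := hF
    refine ⟨hscΛ, haΛ, hbΛ, hsEbd, hne_ab, hne_as, hconn, hΛD, ?_, ?_, ?_⟩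
    · exact fun v hv => (hrows0 v (ball_subset_ball hρ₂ρ hv)).1
    · exact fun v hv => (hrows1 v (ball_subset_ball hρ₂ρ hv)).1
    · intro v hv
      rw [hDs1] at hv
      exact (hrows0 v (hballsρ hv)).1
  -- target transport in `(D'; a; b, s)` with `Λ'`
  have T₂ : Tendsto (fun δ : ℝ =>
      hexParafermionicObservable (Λ' δ) (a δ) hexCriticalFugacity (5 / 8) (sE δ) /
        hexParafermionicObservable (Λ' δ) (a δ) hexCriticalFugacity (5 / 8) (b δ)) (𝓝[>] 0)
      (𝓝 (Complex.exp ((5 / 8 : ℂ) * (L's - L'b)))) := by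
    refine stub_targetTransport hO D' D's (ρ₁ / 2) Λ' m₀ m₁' m₀ a b sE Ψ' L' L'b L's hD's_car hD's0
      (half_pos hρ₁) (by rw [hD'.pt_zero_eq]; exact hf0') (by rw [hD'.pt_one_eq]; exact hf1')
      (by rw [hD's1]; exact hfs') ?_ hKΛ' (by rw [hD'.pt_zero_eq]; exact ha)
      (by rw [hD'.pt_one_eq]; exact hb) (by rw [hD's1]; exact hsE)
      (by rw [hD'.pt_zero_eq]; exact hΨ'inf) (by rw [hD'.pt_one_eq]; exact hΨ'b) hL'c hL'e
      (by rw [hD'.pt_one_eq]; exact hL'b) (by rw [hD's1]; exact hL's)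
    filter_upwards [hev, hevF] with δ hevδ hF
    obtain ⟨-, -, hscΛ', -, hconn', -, -, haΛ', hbΛ', hne', -, hΛ'D', hrows0, hrows1⟩ := hevδ
    obtain ⟨-, hsEbd', -, hne_as', -, -⟩ := hF
    refine ⟨hscΛ', haΛ', hbΛ', hsEbd', hne', hne_as', hconn', hΛ'D', ?_, ?_, ?_⟩
    · intro v hv
      rw [hD'.pt_zero_eq] at hv
      exact (hrows0 v (ball_subset_ball hρ₂ρ hv)).2
    · intro v hv
      rw [hD'.pt_one_eq] at hv
      exact (hrows1 v (ball_subset_ball hρ₂ρ hv)).2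
    · intro v hv
      rw [hD's1] at hv
      exact (hrows0 v (hballsρ hv)).2
  -- the far mass of the chords `a δ → s_δ` beyond `K t` is small (two-piece source locality)
  have hfar := hSLK sE t ht0.ne' (by rw [htabs]; exact htt₀)
    (hevF.mono fun δ hF => ⟨hF.1, hF.2.2.2.2.1⟩) hsE
  -- the squeeze data: `r = Z'(a,s)/Z(a,s)`, `Q = [Z'(a,b)/Z'(a,s)] · [Z(a,s)/Z(a,b)]`, `R = R t`
  refine ⟨fun δ => (∑ γ : HexMidEdgeSAW (Λ' δ) (a δ) (sE δ), hexCriticalFugacity ^ γ.length) /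
      (∑ γ : HexMidEdgeSAW (Λ δ) (a δ) (sE δ), hexCriticalFugacity ^ γ.length),
    fun δ => ((∑ γ : HexMidEdgeSAW (Λ' δ) (a δ) (b δ), hexCriticalFugacity ^ γ.length) /
      (∑ γ : HexMidEdgeSAW (Λ' δ) (a δ) (sE δ), hexCriticalFugacity ^ γ.length)) *
      ((∑ γ : HexMidEdgeSAW (Λ δ) (a δ) (sE δ), hexCriticalFugacity ^ γ.length) /
      (∑ γ : HexMidEdgeSAW (Λ δ) (a δ) (b δ), hexCriticalFugacity ^ γ.length)),
    R t, htR, ?_, ?_⟩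
  · -- `Q → R t`: `Q` is the quotient of the moduli of the two transported ratios
    have hA₂ : ‖Complex.exp ((5 / 8 : ℂ) * (L's - L'b))‖ ≠ 0 := norm_ne_zero_iff.2 (Complex.exp_ne_zero _)
    have hlim := (T₁.norm).div (T₂.norm) hA₂
    have hval : ‖Complex.exp ((5 / 8 : ℂ) * (Ls - Lb))‖ / ‖Complex.exp ((5 / 8 : ℂ) * (L's - L'b))‖ = R t := by
      rw [norm_exp_five_eighths, norm_exp_five_eighths, ← Real.exp_sub, ← hRt]
      congr 1
      ring
    rw [hval] at hlim
    refine hlim.congr' ?_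
    filter_upwards [hev, hevF] with δ hevδ hF
    obtain ⟨-, hscΛ, hscΛ', -, -, haΛ, hbΛ, haΛ', hbΛ', -, -⟩ := hevδ
    obtain ⟨hsEbd, hsEbd', hne_as, hne_as', -, -⟩ := hF
    have h1 := norm_observable_eq_archMass hscΛ haΛ hsEbd (5 / 8)
    have h2 := norm_observable_eq_archMass hscΛ haΛ hbΛ (5 / 8)
    have h3 := norm_observable_eq_archMass hscΛ' haΛ' hsEbd' (5 / 8)
    have h4 := norm_observable_eq_archMass hscΛ' haΛ' hbΛ' (5 / 8)
    have hpos1 := sum_pow_length_pos hne_as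
    have hpos2 := sum_pow_length_pos hne_as'
    simp only [Pi.div_apply, norm_div]
    rw [h1, h2, h3, h4]
    field_simp
  · -- eventually: `f = r · Q` and `1 - η ≤ r ≤ 1`
    filter_upwards [hev, hevF, hevN, hfar, self_mem_nhdsWithin] with δ hevδ hF hne_ab hfarδ hδ
    obtain ⟨hsubΛ, -, -, -, -, haΛ, -, haΛ', -⟩ := hevδ
    obtain ⟨hsEbd, -, hne_as, hne_as', -, hnear⟩ := hF
    have hZpos := sum_pow_length_pos hne_as
    have hZ'pos := sum_pow_length_pos hne_as'
    have hZab := sum_pow_length_pos hne_ab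
    refine ⟨?_, ?_, ?_⟩
    · field_simp
    · -- source locality: the far mass is small, the near walks live in `Λ'`
      have hsplit := archMass_le_archMass_add_farMass_mesh (t := sE δ) (R := ρ / 4) hδ
        (hexDomainBoundary_subset _ haΛ') hnear
      rw [le_div_iff₀ hZpos]
      linarith
    · exact (div_le_one hZpos).2 (archMass_mono hsubΛ (a δ) (sE δ))

end Summit.CriticalPhenomena.SAWScalingLimit.Theorems.ObservableToSLER.Macro

end
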